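import Summits.ResolutionOfSingularities.ResolutionOfSingularities.Theorems.EquisingularLiftEquisingularLiftNatTowerConeDefs
import HarnessLib

/-!
# Route `EquisingularLift`, crux EL♮ (stmt-ResolutionOfSingularities-20038) / EL♮(3) (stmt-…-20148) — rungs DIR₀ / TOWER / NOSE-TOWER, revision ₂:
# E-TRANSPORT COUPLING (res-L1-w45b-plan-1 RULING-6 as amended 2026-08-27T17:58:13Z, res-D-pv-029 g8's objection sustained) + «THE CARRIER IS A CURVE»
# (`Z₉.Infinite`, res-D-pv-029 ASK 18:25:10Z) — append-only successors of …NatTowerConeDefs (p552864), …NatDirZeroRationalDefs (p549939), …NatTowerRationalDefs (p547506)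

res-L1-w45b-lead-2 g2 (lead, text owner). OURS; planning vocabulary of the crux chain, not a statement of any manuscript; AI-written, weaker than
expert review. WHY (RULING-6): the `₁` point-step constructors conclude with BOTH exceptional-surface options — the new plane `υ₂⁻¹{y}` AND the
transported `closure υ₂⁻¹(E ∖ {y})` — unconditionally; but after a point step AT a point `y ∈ E` of a RULED-branch `E` (the exceptional surface of a
round, a `ℙ¹`-bundle datum upstairs) the ruled-surface datum cannot be re-established (`V(St_s 𝓔) = Bl_s V(𝓔) ≇ V(𝓔)`; no T-P1VB supplier on a
blown-up ruled surface). So the transported `E` is offered only when `y ∉ E` or `E` lies over finitely many points of the carrier stage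
(`((γ ≫ υ′) '' E).Finite` — 029's `Tower.NoRound`, unfolded: such an `E` hosts no later `TowerFull` centre). Rounds keep both E-conclusions
unconditionally (new `E` = exceptional divisor of a reduced quasi-regular centre; old `E` exact through a round). And every tower / direction
predicate now says that the carrier `Z₉` is a CURVE (`Z₉.Infinite`), the context conjunct that makes `NoRound` bite; chain authors certify it for free.
* `TowerPtReg₂` / `TowerPtRam₂` — the `₁` binders + ONE last binder `(E' : Set G')` + ONE last hypothesis
  `E' = υ₂⁻¹{y} ∨ ((((γ ≫ υ′) '' E).Finite ∨ y ∉ E) ∧ E' = closure υ₂⁻¹(E ∖ {y}))`, single conclusion `R₁ G' (υ₂ ≫ γ) T' E' K'`;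
* `ReachTower₂` — `ReachTower₁` with `TowerPtReg₂` / `TowerPtRam₂` (round constructor `TowerRound₁` unchanged) and `Z₉.Infinite`;
* `ReachDirZero₁` — `ReachDirZero₀` with `Z₉.Infinite` (so that DIR ⊆ TOWER survives: `reachTower₂_of_reachDirZero₁`);
* `ReachNoseTower₂` — `ReachNoseTower₀` with the `₂` point-step constructors (`F₉ := ℙⁿ_k`, `υ′ := υ`, the nose blow-up), `TowerRound₁`, and `Z.Infinite`
  (the nose's exceptional surface `υ⁻¹Z` is a ruled E from the start, so the E-coupling is NOT vacuous there — unlike the K-coupling);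
* inclusions `reachDirZero₀_of_reachDirZero₁`, `reachTower₁_of_reachTower₂` (₂ ⊆ ₁), `reachTower₂_of_reachDirZero₁` (DIR₀₁ ⊆ TOWER₂) — kernel-checked.
Registered stub NAMES are kept across the revision (names follow the rung, not the predicate revision — plan-1 18:27:13Z); the residues grow by
(T-h) = chains transporting a ruled-branch `E` through a point of `E`.
-/

set_option linter.dupNamespace false

noncomputable section

open CategoryTheory AlgebraicGeometry TopologicalSpace
open Literature.AlgebraicGeometry.Resolution (IsBlowup stalkIdeal)

namespace Summit.ResolutionOfSingularities.ResolutionOfSingularities.Cruxes.EquisingularLiftNat.Sections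

/-- **TOWER / (pt-reg), revision ₂** — `TowerPtReg₁` with the E-transport coupling: the new exceptional surface `E′` is the new plane `υ₂⁻¹{y}`
(always) or the transported `closure υ₂⁻¹(E ∖ {y})` provided `E` lies over finitely many points of the carrier stage or `y ∉ E`. Downstairs only. -/
def TowerPtReg₂ (F₉ F₁₀ : Scheme.{0}) (υ' : F₁₀ ⟶ F₉) (R₁ : ∀ G : Scheme.{0}, (G ⟶ F₁₀) → Set G → Set G → Set G → Prop) : Prop :=
  ∀ (G G' : Scheme.{0}) (γ : G ⟶ F₁₀) (T E K : Set G) (y : redSub G (closure T) isClosed_closure) (υ₂ : G' ⟶ G)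
      (hy : IsClosed ({curvePt G T y} : Set G)) (K' : Set G') (E' : Set G'),
    R₁ G γ T E K →
    ¬ IsRegularLocalRing ((redSub G (closure T) isClosed_closure).presheaf.stalk y) →
    IsRegularLocalRing (G.presheaf.stalk (curvePt G T y)) →
    IsBlowup υ₂ (Scheme.IdealSheafData.vanishingIdeal (⟨{curvePt G T y}, hy⟩ : Closeds G)) →
    (K' = ∅ ∨ (curvePt G T y ∉ closure K ∧ K' = closure (υ₂ ⁻¹' (K \ {curvePt G T y})))) →
    (E' = υ₂ ⁻¹' {curvePt G T y} ∨
      ((((γ ≫ υ') '' E).Finite ∨ curvePt G T y ∉ E) ∧ E' = closure (υ₂ ⁻¹' (E \ {curvePt G T y})))) →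
    R₁ G' (υ₂ ≫ γ) (closure (υ₂ ⁻¹' (T \ {curvePt G T y}))) E' K'

/-- **TOWER / (pt-ram), revision ₂** — `TowerPtRam₁` with the same E-transport coupling. Downstairs only. -/
def TowerPtRam₂ (F₉ F₁₀ : Scheme.{0}) (υ' : F₁₀ ⟶ F₉) (R₁ : ∀ G : Scheme.{0}, (G ⟶ F₁₀) → Set G → Set G → Set G → Prop) : Prop :=
  ∀ (G G' : Scheme.{0}) (γ : G ⟶ F₁₀) (T E K : Set G) (y : redSub G (closure T) isClosed_closure) (J : G.IdealSheafData)
      (υ₂ : G' ⟶ G) (K' : Set G') (E' : Set G'),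
    R₁ G γ T E K →
    ¬ IsRegularLocalRing ((redSub G (closure T) isClosed_closure).presheaf.stalk y) →
    ¬ IsRegularLocalRing (G.presheaf.stalk (curvePt G T y)) →
    (J.support : Set G) = {curvePt G T y} →
    (∃ (ℓ : Fin 3 → G.presheaf.stalk (curvePt G T y)) (hℓ : ∀ i, ℓ i ∈ IsLocalRing.maximalIdeal (G.presheaf.stalk (curvePt G T y))),
      stalkIdeal J (curvePt G T y) = Ideal.span (Set.range ℓ) ∧
      LinearIndependent (IsLocalRing.ResidueField (G.presheaf.stalk (curvePt G T y)))
        (fun i => (IsLocalRing.maximalIdeal (G.presheaf.stalk (curvePt G T y))).toCotangent ⟨ℓ i, hℓ i⟩)) →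
    IsBlowup υ₂ J →
    (K' = ∅ ∨ (curvePt G T y ∉ closure K ∧ K' = closure (υ₂ ⁻¹' (K \ {curvePt G T y})))) →
    (E' = υ₂ ⁻¹' {curvePt G T y} ∨
      ((((γ ≫ υ') '' E).Finite ∨ curvePt G T y ∉ E) ∧ E' = closure (υ₂ ⁻¹' (E \ {curvePt G T y})))) →
    R₁ G' (υ₂ ≫ γ) (closure (υ₂ ⁻¹' (T \ {curvePt G T y}))) E' K'

/-- **ReachTower₂** — `ReachTower₁` with the `₂` point-step constructors and the clause `Z₉.Infinite` (the carrier is a curve).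
Downstairs only; K5′'s `Reach` slot. -/
def ReachTower₂ (F₁ F₂ : Scheme.{0}) (υ : F₂ ⟶ F₁) (x : F₁) (T₂ : Set F₂) (F' : Scheme.{0}) (β : F' ⟶ F₂) (T' : Set F') : Prop :=
  ∃ (W : Set F₁) (K₂ : Set F₂) (F₉ : Scheme.{0}) (β₉ : F₉ ⟶ F₂) (T₉ Z₉ K₉ : Set F₉) (b₉ : Bool) (hZ₉ : IsClosed Z₉)
    (F₁₀ : Scheme.{0}) (υ' : F₁₀ ⟶ F₉) (γ' : F' ⟶ F₁₀) (E' K' : Set F'),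
    x ∈ W ∧ ¬ (υ ⁻¹' {x} ⊆ closure (υ ⁻¹' (W \ {x}))) ∧
    (∃ U : F₁.affineOpens, x ∈ (U : F₁.Opens) ∧
      ((Scheme.IdealSheafData.vanishingIdeal (⟨closure W, isClosed_closure⟩ : Closeds F₁)).ideal U).IsPrincipal) ∧
    υ ⁻¹' {x} ∩ closure (υ ⁻¹' (W \ {x})) ⊆ T₂ ∧
    (K₂ = ∅ ∨ (ConeForm F₁ x W ∧ K₂ = closure (υ ⁻¹' (W \ {x})))) ∧
    InCarrierReachK F₂ T₂ (υ ⁻¹' {x} ∩ closure (υ ⁻¹' (W \ {x}))) K₂ F₉ β₉ T₉ Z₉ K₉ b₉ ∧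
    Z₉ ⊆ T₉ ∧ ¬ (T₉ ⊆ Z₉) ∧ Z₉.Infinite ∧
    Set.Finite {z : redSub F₉ Z₉ hZ₉ | ¬ IsRegularLocalRing ((redSub F₉ Z₉ hZ₉).presheaf.stalk z)} ∧
    IsBlowup υ' (Scheme.IdealSheafData.vanishingIdeal (⟨Z₉, hZ₉⟩ : Closeds F₉)) ∧
    (∀ R₁ : (∀ G : Scheme.{0}, (G ⟶ F₁₀) → Set G → Set G → Set G → Prop),
      R₁ F₁₀ (𝟙 F₁₀) (closure (υ' ⁻¹' (T₉ \ Z₉))) (υ' ⁻¹' Z₉) (closure (υ' ⁻¹' (K₉ \ Z₉))) →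
      TowerPtReg₂ F₉ F₁₀ υ' R₁ → TowerPtRam₂ F₉ F₁₀ υ' R₁ → TowerRound₁ F₉ F₁₀ υ' Z₉ hZ₉ R₁ → R₁ F' γ' T' E' K') ∧
    β = (γ' ≫ υ') ≫ β₉

/-- **ReachDirZero₁** — `ReachDirZero₀` (…NatDirZeroRationalDefs) with the clause `Z₉.Infinite` (the carrier is a curve). Downstairs only. -/
def ReachDirZero₁ (F₁ F₂ : AlgebraicGeometry.Scheme.{0}) (υ : F₂ ⟶ F₁) (x : F₁) (T₂ : Set F₂)
    (F' : AlgebraicGeometry.Scheme.{0}) (β : F' ⟶ F₂) (T' : Set F') : Prop :=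
  ∃ (W : Set F₁) (F₉ : AlgebraicGeometry.Scheme.{0}) (β₉ : F₉ ⟶ F₂) (T₉ Z₉ : Set F₉) (b₉ : Bool) (hZ₉ : IsClosed Z₉)
    (F₁₀ : AlgebraicGeometry.Scheme.{0}) (υ' : F₁₀ ⟶ F₉) (γ' : F' ⟶ F₁₀) (E' : Set F'),
    ((x ∈ W) ∧ (¬ (υ ⁻¹' {x} ⊆ closure (υ ⁻¹' (W \ {x})))) ∧ ((∃ U : F₁.affineOpens, x ∈ (U : F₁.Opens) ∧ ((AlgebraicGeometry.Scheme.IdealSheafData.vanishingIdeal (⟨closure W, isClosed_closure⟩ : TopologicalSpace.Closeds F₁)).ideal U).IsPrincipal)) ∧ ((υ ⁻¹' {x} ∩ closure (υ ⁻¹' (W \ {x}))) ⊆ T₂) ∧ ((∀ R : (∀ G : AlgebraicGeometry.Scheme.{0}, (G ⟶ F₂) → Set G → Set G → Bool → Prop), R F₂ (CategoryTheory.CategoryStruct.id F₂) (T₂) (υ ⁻¹' {x} ∩ closure (υ ⁻¹' (W \ {x}))) false → (∀ (G₁ G₂ : AlgebraicGeometry.Scheme.{0}) (β : G₁ ⟶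 F₂) (T Z : Set G₁) (b : Bool) (y : ↥((AlgebraicGeometry.Scheme.IdealSheafData.vanishingIdeal (⟨closure Z, isClosed_closure⟩ : TopologicalSpace.Closeds G₁))).subscheme) (υ₁ : G₂ ⟶ G₁) (hy : IsClosed ({(((AlgebraicGeometry.Scheme.IdealSheafData.vanishingIdeal (⟨closure Z, isClosed_closure⟩ : TopologicalSpace.Closeds G₁))).subschemeι y : G₁)} : Set G₁)), R G₁ β T Z b → (((AlgebraicGeometry.Scheme.IdealSheafData.vanishingIdeal (⟨closure Z, isClosed_closure⟩ : TopologicalSpace.Closeds G₁))).subschemeι y : G₁) ∈ T → IsRegularLocalRing (((AlgebraicGeometry.Scheme.IdealSheafData.vanishingIdeal (⟨closure Z, isClosed_closure⟩ : TopologicalSpace.Closeds G₁))).subscheme.presheaf.stalk y) → IsRegularLocalRing (G₁.presheaf.stalk (((AlgebraicGeometry.Scheme.IdealSheafData.vanishingIdeal (⟨closure Z, isClosed_closure⟩ : TopologicalSpace.Closeds G₁))).subschemeι y : G₁)) → Literature.AlgebraicGeometry.Resolution.IsBlowup υ₁ (AlgebraicGeometry.Scheme.IdealSheafData.vanishingIdeal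 (⟨{(((AlgebraicGeometry.Scheme.IdealSheafData.vanishingIdeal (⟨closure Z, isClosed_closure⟩ : TopologicalSpace.Closeds G₁))).subschemeι y : G₁)}, hy⟩ : TopologicalSpace.Closeds G₁)) → R G₂ (CategoryTheory.CategoryStruct.comp υ₁ β) (closure (υ₁ ⁻¹' (T \ {(((AlgebraicGeometry.Scheme.IdealSheafData.vanishingIdeal (⟨closure Z, isClosed_closure⟩ : TopologicalSpace.Closeds G₁))).subschemeι y : G₁)}))) (closure (υ₁ ⁻¹' (Z \ {(((AlgebraicGeometry.Scheme.IdealSheafData.vanishingIdeal (⟨closure Z, isClosed_closure⟩ : TopologicalSpace.Closeds G₁))).subschemeι y : G₁)}))) b) → (∀ (G₁ G₂ : AlgebraicGeometry.Scheme.{0}) (β : G₁ ⟶ F₂) (T Z : Set G₁) (y : ↥((AlgebraicGeometry.Scheme.IdealSheafData.vanishingIdeal (⟨closure Z, isClosed_closure⟩ : TopologicalSpace.Closeds G₁))).subscheme) (υ₁ : G₂ ⟶ G₁) (hy : IsClosed ({(((AlgebraicGeometry.Scheme.IdealSheafData.vanishingIdeal (⟨closure Z, isClosed_closure⟩ : TopologicalSpace.Closeds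 G₁))).subschemeι y : G₁)} : Set G₁)), R G₁ β T Z false → (((AlgebraicGeometry.Scheme.IdealSheafData.vanishingIdeal (⟨closure Z, isClosed_closure⟩ : TopologicalSpace.Closeds G₁))).subschemeι y : G₁) ∈ T → ¬ IsRegularLocalRing (((AlgebraicGeometry.Scheme.IdealSheafData.vanishingIdeal (⟨closure Z, isClosed_closure⟩ : TopologicalSpace.Closeds G₁))).subscheme.presheaf.stalk y) → IsRegularLocalRing (G₁.presheaf.stalk (((AlgebraicGeometry.Scheme.IdealSheafData.vanishingIdeal (⟨closure Z, isClosed_closure⟩ : TopologicalSpace.Closeds G₁))).subschemeι y : G₁)) → Literature.AlgebraicGeometry.Resolution.IsBlowup υ₁ (AlgebraicGeometry.Scheme.IdealSheafData.vanishingIdeal (⟨{(((AlgebraicGeometry.Scheme.IdealSheafData.vanishingIdeal (⟨closure Z, isClosed_closure⟩ : TopologicalSpace.Closeds G₁))).subschemeι y : G₁)}, hy⟩ : TopologicalSpace.Closeds G₁)) → R G₂ (CategoryTheory.CategoryStruct.comp υ₁ β) (closure (υ₁ ⁻¹' (T \ {(((AlgebraicGeometry.Scheme.IdealSheafData.vanishingIdeal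 (⟨closure Z, isClosed_closure⟩ : TopologicalSpace.Closeds G₁))).subschemeι y : G₁)}))) (closure (υ₁ ⁻¹' (Z \ {(((AlgebraicGeometry.Scheme.IdealSheafData.vanishingIdeal (⟨closure Z, isClosed_closure⟩ : TopologicalSpace.Closeds G₁))).subschemeι y : G₁)}))) true) → R F₉ β₉ T₉ Z₉ b₉)) ∧ (Z₉ ⊆ T₉) ∧ (¬ (T₉ ⊆ Z₉)) ∧ (Set.Finite {z : ↥((AlgebraicGeometry.Scheme.IdealSheafData.vanishingIdeal (⟨Z₉, hZ₉⟩ : TopologicalSpace.Closeds F₉))).subscheme | ¬ IsRegularLocalRing (((AlgebraicGeometry.Scheme.IdealSheafData.vanishingIdeal (⟨Z₉, hZ₉⟩ : TopologicalSpace.Closeds F₉))).subscheme.presheaf.stalk z)}) ∧ (Literature.AlgebraicGeometry.Resolution.IsBlowup υ' (AlgebraicGeometry.Scheme.IdealSheafData.vanishingIdeal (⟨Z₉, hZ₉⟩ : TopologicalSpace.Closeds F₉)))) ∧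
    RationalCarrier (redSub F₉ Z₉ hZ₉) ∧
    Z₉.Infinite ∧
    (∀ R₁ : (∀ G : AlgebraicGeometry.Scheme.{0}, (G ⟶ F₁₀) → Set G → Set G → Prop),
      R₁ F₁₀ (𝟙 F₁₀) (closure (υ' ⁻¹' (T₉ \ Z₉))) (υ' ⁻¹' Z₉) → DirStep F₉ F₁₀ υ' Z₉ hZ₉ R₁ → R₁ F' γ' T' E') ∧
    β = (γ' ≫ υ') ≫ β₉

/-- **NOSE-TOWER, revision ₂** — `ReachNoseTower₀` (…NatTowerRationalDefs) with the `₂` point-step constructors (carrier stage `ℙⁿ_k`, carrier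
blow-up the nose blow-up `υ`), `TowerRound₁`, and `Z.Infinite`. Downstairs only. -/
def ReachNoseTower₂ (k : Type) [Field k] (n : ℕ) (H : Scheme.{0})
    (ι : H ⟶ (Literature.AlgebraicGeometry.Motives.projectiveSpace n k).left) : Prop :=
  ∃ (Z : Set (Literature.AlgebraicGeometry.Motives.projectiveSpace n k).left) (hZ : IsClosed Z),
    IsLiftableNoseClass₂ k n Z ∧ Z ⊆ Set.range ι ∧ ¬ (Set.range ι ⊆ Z) ∧ Z.Infinite ∧
    Nonempty (redSub (Literature.AlgebraicGeometry.Motives.projectiveSpace n k).left Z hZ ≅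
      (Literature.AlgebraicGeometry.Motives.projectiveSpace 1 k).left) ∧
    ∃ (F₂ : Scheme.{0}) (υ : F₂ ⟶ (Literature.AlgebraicGeometry.Motives.projectiveSpace n k).left),
      IsBlowup υ (Scheme.IdealSheafData.vanishingIdeal
        (⟨Z, hZ⟩ : Closeds (Literature.AlgebraicGeometry.Motives.projectiveSpace n k).left)) ∧
      ∃ (F' : Scheme.{0}) (γ' : F' ⟶ F₂) (T' E' K' : Set F'),
        (∀ R₁ : (∀ G : Scheme.{0}, (G ⟶ F₂) → Set G → Set G → Set G → Prop),
          R₁ F₂ (𝟙 F₂) (closure (υ ⁻¹' (Set.range ι \ Z))) (υ ⁻¹' Z) ∅ →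
          TowerPtReg₂ (Literature.AlgebraicGeometry.Motives.projectiveSpace n k).left F₂ υ R₁ →
          TowerPtRam₂ (Literature.AlgebraicGeometry.Motives.projectiveSpace n k).left F₂ υ R₁ →
          TowerRound₁ (Literature.AlgebraicGeometry.Motives.projectiveSpace n k).left F₂ υ Z hZ R₁ →
          R₁ F' γ' T' E' K') ∧
        Literature.AlgebraicGeometry.Resolution.Scheme.IsRegular (redSub F' (closure T') isClosed_closure)

/-- DIR₀₁ ⊆ DIR₀₀: drop the curve clause. [OURS · pure logic] -/
theorem reachDirZero₀_of_reachDirZero₁ (F₁ F₂ : Scheme.{0}) (υ : F₂ ⟶ F₁) (x : F₁) (T₂ : Set F₂) (F' : Scheme.{0}) (β : F' ⟶ F₂)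
    (T' : Set F') (h : ReachDirZero₁ F₁ F₂ υ x T₂ F' β T') : ReachDirZero₀ F₁ F₂ υ x T₂ F' β T' := by
  obtain ⟨W, F₉, β₉, T₉, Z₉, b₉, hZ₉, F₁₀, υ', γ', E', htc, hrat, -, hdir, hβ⟩ := h
  exact ⟨W, F₉, β₉, T₉, Z₉, b₉, hZ₉, F₁₀, υ', γ', E', htc, hrat, hdir, hβ⟩

/-- Closure under the `₁` point-step constructor implies closure under the `₂` one (the `₂` conclusions are among the `₁` conclusions). -/
theorem towerPtReg₂_of_towerPtReg₁ (F₉ F₁₀ : Scheme.{0}) (υ' : F₁₀ ⟶ F₉)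
    (R₁ : ∀ G : Scheme.{0}, (G ⟶ F₁₀) → Set G → Set G → Set G → Prop) (h : TowerPtReg₁ F₁₀ R₁) : TowerPtReg₂ F₉ F₁₀ υ' R₁ := by
  intro G G' γ T E K y υ₂ hy K' E' hR hT hG hυ₂ hK' hE'
  obtain ⟨h1, h2⟩ := h G G' γ T E K y υ₂ hy K' hR hT hG hυ₂ hK'
  rcases hE' with rfl | ⟨-, rfl⟩
  · exact h1
  · exact h2

/-- Closure under the `₁` fat-point constructor implies closure under the `₂` one. -/
theorem towerPtRam₂_of_towerPtRam₁ (F₉ F₁₀ : Scheme.{0}) (υ' : F₁₀ ⟶ F₉)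
    (R₁ : ∀ G : Scheme.{0}, (G ⟶ F₁₀) → Set G → Set G → Set G → Prop) (h : TowerPtRam₁ F₁₀ R₁) : TowerPtRam₂ F₉ F₁₀ υ' R₁ := by
  intro G G' γ T E K y J υ₂ K' E' hR hT hG hJ hℓ hυ₂ hK' hE'
  obtain ⟨h1, h2⟩ := h G G' γ T E K y J υ₂ K' hR hT hG hJ hℓ hυ₂ hK'
  rcases hE' with rfl | ⟨-, rfl⟩
  · exact h1
  · exact h2

/-- **TOWER₂ ⊆ TOWER₁**: a revision-₂ chain is a revision-₁ chain (a stage family closed under the `₁` constructors is closed under the `₂` ones;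
the curve clause is dropped). [OURS · pure logic] -/
theorem reachTower₁_of_reachTower₂ (F₁ F₂ : Scheme.{0}) (υ : F₂ ⟶ F₁) (x : F₁) (T₂ : Set F₂) (F' : Scheme.{0}) (β : F' ⟶ F₂)
    (T' : Set F') (h : ReachTower₂ F₁ F₂ υ x T₂ F' β T') : ReachTower₁ F₁ F₂ υ x T₂ F' β T' := by
  obtain ⟨W, K₂, F₉, β₉, T₉, Z₉, K₉, b₉, hZ₉, F₁₀, υ', γ', E', K', h1, h2, h3, h4, h5, h6, h7, h8, -, h9, h10, hcl, hβ⟩ := h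
  exact ⟨W, K₂, F₉, β₉, T₉, Z₉, K₉, b₉, hZ₉, F₁₀, υ', γ', E', K', h1, h2, h3, h4, h5, h6, h7, h8, h9, h10,
    fun R₁ hseed hreg hram hround => hcl R₁ hseed (towerPtReg₂_of_towerPtReg₁ F₉ F₁₀ υ' R₁ hreg)
      (towerPtRam₂_of_towerPtRam₁ F₉ F₁₀ υ' R₁ hram) hround, hβ⟩

/-- **DIR₀₁ ⊆ TOWER₂**: every rational-carrier direction chain over a curve carrier is a `ReachTower₂` chain — shadow `∅` throughout, `K′ = ∅`
through every round (which only uses the round constructor, untouched by the E-coupling). [OURS · pure logic] -/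
theorem reachTower₂_of_reachDirZero₁ (F₁ F₂ : Scheme.{0}) (υ : F₂ ⟶ F₁) (x : F₁) (T₂ : Set F₂) (F' : Scheme.{0}) (β : F' ⟶ F₂)
    (T' : Set F') (h : ReachDirZero₁ F₁ F₂ υ x T₂ F' β T') : ReachTower₂ F₁ F₂ υ x T₂ F' β T' := by
  obtain ⟨W, F₉, β₉, T₉, Z₉, b₉, hZ₉, F₁₀, υ', γ', E', ⟨hxW, hnot, hWpr, hZT, hinner, hZ₉T₉, hT₉Z₉, hfin, hυ'⟩, hrat, hinf, hdir, hβ⟩ := h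
  obtain ⟨K₉, hK₉⟩ := exists_inCarrierReachK F₂ T₂ (υ ⁻¹' {x} ∩ closure (υ ⁻¹' (W \ {x}))) ∅ F₉ β₉ T₉ Z₉ b₉ hinner
  let ReachT : ∀ G : Scheme.{0}, (G ⟶ F₁₀) → Set G → Set G → Set G → Prop := fun G γ T E K =>
    ∀ R₁ : (∀ G : Scheme.{0}, (G ⟶ F₁₀) → Set G → Set G → Set G → Prop),
      R₁ F₁₀ (𝟙 F₁₀) (closure (υ' ⁻¹' (T₉ \ Z₉))) (υ' ⁻¹' Z₉) (closure (υ' ⁻¹' (K₉ \ Z₉))) →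
      TowerPtReg₂ F₉ F₁₀ υ' R₁ → TowerPtRam₂ F₉ F₁₀ υ' R₁ → TowerRound₁ F₉ F₁₀ υ' Z₉ hZ₉ R₁ → R₁ G γ T E K
  have hreach : ∃ K' : Set F', ReachT F' γ' T' E' K' := by
    refine hdir (fun G γ T E => ∃ K : Set G, ReachT G γ T E K) ⟨closure (υ' ⁻¹' (K₉ \ Z₉)), fun R₁ hseed _ _ _ => hseed⟩ ?_
    intro G G'' γ T E hE Γ hΓ υ₂ ⟨K, hK⟩ hΓET hΓirr hsec hGreg hEreg hunobs hυ₂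
    have hstep : ∀ R₁ : (∀ G : Scheme.{0}, (G ⟶ F₁₀) → Set G → Set G → Set G → Prop),
        R₁ F₁₀ (𝟙 F₁₀) (closure (υ' ⁻¹' (T₉ \ Z₉))) (υ' ⁻¹' Z₉) (closure (υ' ⁻¹' (K₉ \ Z₉))) →
        TowerPtReg₂ F₉ F₁₀ υ' R₁ → TowerPtRam₂ F₉ F₁₀ υ' R₁ → TowerRound₁ F₉ F₁₀ υ' Z₉ hZ₉ R₁ →
        R₁ G'' (υ₂ ≫ γ) (closure (υ₂ ⁻¹' (T \ Γ))) (υ₂ ⁻¹' Γ) ∅ ∧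
          R₁ G'' (υ₂ ≫ γ) (closure (υ₂ ⁻¹' (T \ Γ))) (closure (υ₂ ⁻¹' (E \ Γ))) ∅ := by
      intro R₁ hseed hreg hram hround
      have hfull : TowerFull F₉ F₁₀ υ' Z₉ hZ₉ G γ Γ hΓ := by
        obtain ⟨δ, hδ, hiso⟩ := hsec
        exact ⟨δ, hδ, inferInstance, inferInstance, δ.surjective⟩
      exact hround G G'' γ T E K hE Γ hΓ υ₂ ∅ (hK R₁ hseed hreg hram hround) hΓET hΓirr.nonempty hfull
        (Or.inl ⟨hrat, hGreg, hEreg, hunobs⟩) hυ₂ (Or.inl rfl)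
    exact ⟨⟨∅, fun R₁ hseed hreg hram hround => (hstep R₁ hseed hreg hram hround).1⟩,
      ⟨∅, fun R₁ hseed hreg hram hround => (hstep R₁ hseed hreg hram hround).2⟩⟩
  obtain ⟨K', hK'⟩ := hreach
  exact ⟨W, ∅, F₉, β₉, T₉, Z₉, K₉, b₉, hZ₉, F₁₀, υ', γ', E', K', hxW, hnot, hWpr, hZT, Or.inl rfl, hK₉, hZ₉T₉, hT₉Z₉, hinf, hfin, hυ',
    hK', hβ⟩

end Summit.ResolutionOfSingularities.ResolutionOfSingularities.Cruxes.EquisingularLiftNat.Sections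

end
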